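import Literature.NumberTheory.EllipticCurves.IsogenyDegreePullbackXProofs
import Literature.NumberTheory.EllipticCurves.IsogenyDegreeKernelProofs
import Literature.NumberTheory.EllipticCurves.IsogenyDualProofs
import Literature.NumberTheory.EllipticCurves.HeightsProofs
import Mathlib.FieldTheory.SeparableDegree
import Mathlib.RingTheory.EuclideanDomain
import Mathlib.FieldTheory.Galois.Infinite
import Mathlib.Algebra.Polynomial.Lifts
import HarnessLib

/-!
# The `x`-coordinate of an isogeny is a `K`-rational function of `x` of degree `deg φ`

Topic `NumberTheory/EllipticCurves`. A *proofs* file (theorems only, no definitions, no named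
facts) on top of the prelude `Literature.NumberTheory.EllipticCurves.Isogeny` (an isogeny over `K`
recorded by its `Γ_K`-equivariant, algebraic homomorphism on `K̄`-points) and the degree theory of
the tree (`IsogenyDegree`, `IsogenyDegreeProofs`, `IsogenyDegreeKernelProofs`,
`IsogenyDegreePullbackXProofs`). It proves the classical normal form of the first coordinate of an
isogeny (Silverman, *AEC*, III.§4, Remark 4.13.3 and Exercise 3.7(d); III.§2 for even functions):

* `WeierstrassCurve.Isogeny.exists_xy_apply_eq_eval_map_div` — **for a `K`-isogeny
  `φ : E → E'` of elliptic curves over a field `K` of characteristic `0` there are coprime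
  `a, b ∈ K[X]` with `max(deg a, deg b) = deg φ = #ker φ` and `x(φ P) = a(x(P))/b(x(P))`
  (`b(x(P)) ≠ 0`, `φ P ≠ O`) for all but finitely many `P ∈ E(K̄)`.**

It is the geometric input of the functoriality of the canonical height under isogenies
(`IsogenyCanonicalHeightProofs`: `ĥ_{E'}(φ P) = deg φ · ĥ_E(P)`, and the adjointness of `φ`
and `φ̂` for the Néron–Tate pairings used in Milne's proof of *ADT* Thm. I.7.3).

## The proof

1. `WeierstrassCurve.exists_eval_eq_add_mul_of_equation`: every `g ∈ K̄[x, y]` is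
   `A(x) + B(x) y` on the affine curve (division by the Weierstrass polynomial, monic of degree `2`
   in `y`); `exists_eval_eq_of_symmetric`: if `g(x, ȳ) = g(x, y)` on the curve
   (`ȳ = -y - a₁x - a₃`) then `g = A(x)` on the curve, because `B(x)(2y + a₁x + a₃)` vanishes at
   every affine point, hence in the coordinate ring (the tree's `finite_setOf_evalEval_eq_zero`:
   a non-zero element of `K̄[E]` has finitely many zeros, and `E(K̄)` is infinite), which forces
   `B = 0` by degree.
2. `Isogeny.exists_xy_apply_eq_eval_div`: off the exceptional set of a rational representation
   `(P₁/Q₁, P₂/Q₂)` of `φ`, `x(φ P) = P₁(P) Q₁(-P) / (Q₁(P) Q₁(-P))`, and since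
   `x(φ(-P)) = x(-φ P) = x(φ P)` both `P₁ Q̄₁` and `Q₁ Q̄₁` are even on the curve, hence
   polynomials `u(x)`, `n(x)`; reduce `u/n` to lowest terms with monic denominator
   (`Literature.NumberTheory.EllipticCurves.exists_isCoprime_monic_eval_div_eq`).
3. `Isogeny.map_eq_of_xy_apply_eq`: `φ ∘ σ = σ ∘ φ` for `σ ∈ Gal(K̄/K)` gives
   `a(σx)/b(σx) = σ(a(x)/b(x))` at infinitely many `x` (`infinite_image_xy_zero`), so
   `a · σb = σa · b`, whence `σa = a`, `σb = b` (`map_eq_of_mul_map_eq`: coprime, `b` monic), and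
   the coefficients lie in `K` (`exists_map_eq_of_forall_map_eq`, Mathlib's
   `InfiniteGalois.mem_range_algebraMap_iff_fixed`, `K̄/K` Galois in characteristic `0`).
4. `Isogeny.deg_eq_max_natDegree_of_xy_apply_eq`: the pointwise identity gives
   `φ^* x' = a(x)/b(x)` in `K̄(E)` (`evalGeneric_eq_zero_of_finite`), so
   `deg φ = max(deg a, deg b)` (`Isogeny.deg_eq_max_natDegree_of_pullbackX_eq`);
   `Isogeny.degree_eq_deg`: `#ker φ = deg_s φ = deg φ` in characteristic `0`
   (`card_ker_eq_finSepDegree_holds`, separability).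

## References

* [SilvermanAEC2009] J. H. Silverman, *The Arithmetic of Elliptic Curves*, 2nd ed., GTM 106
  (2009): III.§2 (Cor. III.2.3.1, even functions), III.§3 (Prop. III.3.1), III.§4 (Remark 4.13.3,
  Thm. III.4.10(a),(c)), Exercise 3.7(d), I.§3 (maps defined over `K`).

## Design

Theorems only; `noncomputable section`, `open scoped Classical`, one universe `u`; dot-notation
extensions in `namespace WeierstrassCurve(.Isogeny)`, general polynomial lemmas in
`namespace Literature.NumberTheory.EllipticCurves` (path namespace). Nothing is defined: the
conjugate polynomial `ḡ = g(x, -y - a₁x - a₃)` is a `MvPolynomial.bind₁` written out where used.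
-/

noncomputable section

open scoped Classical

open Polynomial
open scoped Polynomial.Bivariate

universe u
namespace WeierstrassCurve

open geomPoints


variable {K : Type u} [Field K] {W W' : WeierstrassCurve K}

section XOnly

variable (W)

/-- **Every polynomial function on the affine curve is `A(x) + B(x) y`**: for `g ∈ K̄[x, y]` there
are `A, B ∈ K̄[X]` with `g(x, y) = A(x) + B(x) y` at every point `(x, y)` of the affine curve
`E/K̄` (division with remainder by the Weierstrass polynomial, monic of degree `2` in `y`;
Silverman, *AEC*, III.§3, proof of Prop. III.3.1, "`K[x, y] = K[x] ⊕ K[x] y`"; Mathlib's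
`WeierstrassCurve.Affine.CoordinateRing.basis`). [folklore] -/
theorem exists_eval_eq_add_mul_of_equation (g : MvPolynomial (Fin 2) (AlgebraicClosure K)) :
    ∃ A B : (AlgebraicClosure K)[X], ∀ x y : AlgebraicClosure K,
      (W.baseChange (AlgebraicClosure K)).toAffine.Equation x y →
        MvPolynomial.eval ![x, y] g = A.eval x + B.eval x * y := by
  set V := (W.baseChange (AlgebraicClosure K)).toAffine with hV
  set g₂ : (AlgebraicClosure K)[X][Y] :=
    (Polynomial.Bivariate.equivMvPolynomial (AlgebraicClosure K)).symm g with hg₂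
  set ρ := g₂ %ₘ V.polynomial with hρ
  refine ⟨ρ.coeff 0, ρ.coeff 1, fun x y hxy ↦ ?_⟩
  have hdeg : ρ.degree ≤ 1 := by
    have h := Polynomial.degree_modByMonic_lt g₂ (Affine.monic_polynomial (W := V))
    rw [Affine.degree_polynomial] at h
    exact Order.le_of_lt_succ h
  have hρeq : ρ = C (ρ.coeff 1) * Polynomial.X + C (ρ.coeff 0) := eq_X_add_C_of_degree_le_one hdeg
  have hdiv := Polynomial.modByMonic_add_div g₂ V.polynomial
  have hxy' : V.polynomial.evalEval x y = 0 := hxy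
  rw [eval_eq_evalEval_equivMvPolynomial_symm, ← hg₂, ← hdiv, evalEval_add, evalEval_mul, hxy',
    zero_mul, add_zero, ← hρ]
  conv_lhs => rw [hρeq]
  simp only [evalEval_add, evalEval_mul, evalEval_C, evalEval_X]
  ring

variable {W}

/-- **The hyperelliptic conjugate of a polynomial function**: for `g ∈ K̄[x, y]` the polynomial
`ḡ(x, y) = g(x, -y - a₁x - a₃)` satisfies `ḡ(P) = g(-P)` at affine points. [folklore] -/
theorem eval_bind₁_negY (g : MvPolynomial (Fin 2) (AlgebraicClosure K)) (x y : AlgebraicClosure K) :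
    MvPolynomial.eval ![x, y]
      (MvPolynomial.bind₁ ![MvPolynomial.X 0,
        -MvPolynomial.X 1 - MvPolynomial.C ((W.baseChange (AlgebraicClosure K)).a₁) *
          MvPolynomial.X 0 - MvPolynomial.C ((W.baseChange (AlgebraicClosure K)).a₃)] g) =
      MvPolynomial.eval ![x, (W.baseChange (AlgebraicClosure K)).toAffine.negY x y] g := by
  change MvPolynomial.eval₂Hom (RingHom.id _) ![x, y] (MvPolynomial.bind₁ _ g) = _
  rw [MvPolynomial.eval₂Hom_bind₁]
  change MvPolynomial.eval _ g = _
  congr 2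
  funext i
  fin_cases i
  · simp
  · simp [Affine.negY]

variable (W) in
/-- **A polynomial function invariant under `P ↦ -P` is a polynomial in `x`**: if `g ∈ K̄[x, y]`
takes the same value at `(x, y)` and `(x, -y - a₁x - a₃)` for every point of the affine curve
(in characteristic `0`), then `g(x, y) = A(x)` on the curve for some `A ∈ K̄[X]`. Writing
`g ≡ A + B y`, the polynomial `B(x) (2y + a₁x + a₃)` vanishes at every affine point, hence is
divisible by the Weierstrass polynomial (the tree's `finite_setOf_evalEval_eq_zero`: a non-zero
element of `K̄[E]` has finitely many zeros, while `E(K̄)` is infinite), which forces `B = 0` by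
degree. Silverman, *AEC*, III.§2–3 (even functions lie in `K̄(x)`). [folklore] -/
theorem exists_eval_eq_of_symmetric [W.IsElliptic] [CharZero K]
    (g : MvPolynomial (Fin 2) (AlgebraicClosure K))
    (hsymm : ∀ x y : AlgebraicClosure K, (W.baseChange (AlgebraicClosure K)).toAffine.Equation x y →
      MvPolynomial.eval ![x, (W.baseChange (AlgebraicClosure K)).toAffine.negY x y] g =
        MvPolynomial.eval ![x, y] g) :
    ∃ A : (AlgebraicClosure K)[X], ∀ x y : AlgebraicClosure K,
      (W.baseChange (AlgebraicClosure K)).toAffine.Equation x y →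
        MvPolynomial.eval ![x, y] g = A.eval x := by
  set V := (W.baseChange (AlgebraicClosure K)).toAffine with hV
  obtain ⟨A, B, hAB⟩ := W.exists_eval_eq_add_mul_of_equation g
  -- `B(x) (y - ȳ) = 0` on the curve
  have hB : ∀ x y : AlgebraicClosure K, V.Equation x y → B.eval x * (y - V.negY x y) = 0 := by
    intro x y hxy
    have h1 := hAB x y hxy
    have h2 := hAB x (V.negY x y) ((Affine.equation_neg x y).mpr hxy)
    have h3 := hsymm x y hxy
    rw [h1, h2] at h3
    linear_combination -h3
  -- the bivariate polynomial `B(X) (2Y + a₁X + a₃)` vanishes at all affine points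
  set p : (AlgebraicClosure K)[X][Y] := C B * (C (C 2) * Polynomial.X + C (C V.a₁ * Polynomial.X + C V.a₃))
    with hp
  have hpeval : ∀ x y : AlgebraicClosure K, V.Equation x y → p.evalEval x y = 0 := by
    intro x y hxy
    have := hB x y hxy
    simp only [hp, evalEval_mul, evalEval_add, evalEval_C, evalEval_X, eval_add, eval_mul, eval_C,
      eval_X]
    simp only [Affine.negY] at this
    linear_combination this
  -- hence it is zero in the coordinate ring (finitely many zeros otherwise, but `E(K̄)` is infinite)
  have hmk : Affine.CoordinateRing.mk V p = 0 := by
    by_contra h0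
    have hfin := finite_setOf_evalEval_eq_zero (W.baseChange (AlgebraicClosure K)) h0
    apply geomPoints.infinite_ne_zero (W := W)
    refine hfin.subset ?_
    intro P hP
    change (W.baseChange (AlgebraicClosure K)).toAffine.Point at P
    rcases P with _ | ⟨x, y, h⟩
    · exact (hP rfl).elim
    · exact ⟨x, y, h, rfl, hpeval x y h.1⟩
  -- and zero as a polynomial, by degree in `Y`
  have hp0 : p = 0 := by
    rw [Affine.CoordinateRing.mk, AdjoinRoot.mk_eq_zero] at hmk
    refine Polynomial.eq_zero_of_dvd_of_degree_lt hmk ?_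
    rw [Affine.degree_polynomial]
    refine lt_of_le_of_lt (degree_mul_le _ _) ?_
    calc (C B).degree + (C (C 2) * Polynomial.X + C (C V.a₁ * Polynomial.X + C V.a₃)).degree
        ≤ 0 + 1 := add_le_add degree_C_le (degree_linear_le)
      _ < 2 := by norm_num
  -- so `B = 0`
  have hB0 : B = 0 := by
    have h2 : (C (C 2) * Polynomial.X + C (C V.a₁ * Polynomial.X + C V.a₃) :
        (AlgebraicClosure K)[X][Y]) ≠ 0 := by
      intro h
      have := congrArg (fun q ↦ q.coeff 1) h
      simp at this
    rw [hp] at hp0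
    rcases mul_eq_zero.mp hp0 with h | h
    · exact C_eq_zero.mp h
    · exact (h2 h).elim
  refine ⟨A, fun x y hxy ↦ ?_⟩
  rw [hAB x y hxy, hB0, eval_zero, zero_mul, add_zero]

end XOnly

end WeierstrassCurve






namespace Literature.NumberTheory.EllipticCurves

section PolynomialLemmas

variable {F : Type*} [Field F]

/-- **Lowest terms with monic denominator.** For `u, n ∈ F[X]` with `n ≠ 0` there are coprime
`a, b ∈ F[X]`, `b` monic, with `a(x)/b(x) = u(x)/n(x)` and `b(x) ≠ 0` wherever `n(x) ≠ 0`
(divide by `gcd(u, n)` and by the leading coefficient). [folklore] -/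
theorem exists_isCoprime_monic_eval_div_eq (u n : F[X]) (hn : n ≠ 0) :
    ∃ a b : F[X], IsCoprime a b ∧ b.Monic ∧
      ∀ x : F, n.eval x ≠ 0 → b.eval x ≠ 0 ∧ a.eval x / b.eval x = u.eval x / n.eval x := by
  set g := GCDMonoid.gcd u n with hg
  have hg0 : g ≠ 0 := gcd_ne_zero_of_right hn
  set u' := u / g with hu'
  set n' := n / g with hn'
  have hu : u = g * u' := (EuclideanDomain.mul_div_cancel' hg0 (GCDMonoid.gcd_dvd_left u n)).symm
  have hnn : n = g * n' := (EuclideanDomain.mul_div_cancel' hg0 (GCDMonoid.gcd_dvd_right u n)).symm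
  have hcop : IsCoprime u' n' := isCoprime_div_gcd_div_gcd hn
  have hn'0 : n' ≠ 0 := right_div_gcd_ne_zero hn
  set c := n'.leadingCoeff with hc
  have hc0 : c ≠ 0 := leadingCoeff_ne_zero.mpr hn'0
  refine ⟨u' * C c⁻¹, n' * C c⁻¹, ?_, monic_mul_leadingCoeff_inv hn'0, fun x hx ↦ ?_⟩
  · have hunit : IsUnit (C c⁻¹) := isUnit_C.mpr (IsUnit.mk0 _ (inv_ne_zero hc0))
    exact (isCoprime_mul_unit_right_left hunit _ _).mpr
      ((isCoprime_mul_unit_right_right hunit _ _).mpr hcop)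
  · rw [hnn, eval_mul] at hx
    have hgx : g.eval x ≠ 0 := left_ne_zero_of_mul hx
    have hn'x : n'.eval x ≠ 0 := right_ne_zero_of_mul hx
    have hcx : (C c⁻¹ : F[X]).eval x ≠ 0 := by
      rw [eval_C]; exact inv_ne_zero hc0
    refine ⟨by rw [eval_mul]; exact mul_ne_zero hn'x hcx, ?_⟩
    rw [eval_mul, eval_mul, hu, hnn, eval_mul, eval_mul, mul_div_mul_right _ _ hcx,
      mul_div_mul_left _ _ hgx]

/-- **Galois descent of a fraction in lowest terms.** If `a, b ∈ F[X]` are coprime, `b` is monic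
and `a · σb = σa · b` for a ring endomorphism `σ` of `F` (injective on a field), then `σa = a`
and `σb = b`: `b ∣ σb` with equal degrees and both monic. [folklore] -/
theorem map_eq_of_mul_map_eq {a b : F[X]} (hab : IsCoprime a b) (hb : b.Monic) (σ : F →+* F)
    (h : a * b.map σ = a.map σ * b) : a.map σ = a ∧ b.map σ = b := by
  have hb0 : b ≠ 0 := hb.ne_zero
  -- `b ∣ σb`
  have hdvd : b ∣ b.map σ := by
    have : b ∣ a * b.map σ := ⟨a.map σ, by rw [h, mul_comm]⟩
    exact hab.symm.dvd_of_dvd_mul_left this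
  obtain ⟨w, hw⟩ := hdvd
  have hmon : (b.map σ).Monic := hb.map σ
  have hdeg : (b.map σ).natDegree = b.natDegree := natDegree_map_eq_of_injective σ.injective b
  have hw0 : w ≠ 0 := by
    rintro rfl
    rw [mul_zero] at hw
    exact hmon.ne_zero hw
  have hwdeg : w.natDegree = 0 := by
    have := congrArg natDegree hw
    rw [natDegree_mul hb0 hw0, hdeg] at this
    omega
  obtain ⟨c, rfl⟩ := natDegree_eq_zero.mp hwdeg
  have hc1 : c = 1 := by
    have h1 := hmon.leadingCoeff
    rw [hw, leadingCoeff_mul, leadingCoeff_C, hb.leadingCoeff, one_mul] at h1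
    exact h1
  subst hc1
  rw [map_one, mul_one] at hw
  refine ⟨?_, hw⟩
  rw [hw] at h
  exact (mul_right_cancel₀ hb0 h).symm

/-- A polynomial over `F` all of whose coefficients are fixed by every `K`-automorphism of `F`
descends to `K`, when `F/K` is Galois (e.g. `F = K̄`, `K` perfect).
Mathlib's `InfiniteGalois.mem_range_algebraMap_iff_fixed`, coefficientwise. [folklore] -/
theorem exists_map_eq_of_forall_map_eq {K F : Type*} [Field K] [Field F] [Algebra K F]
    [IsGalois K F] {p : F[X]} (hp : ∀ σ : F ≃ₐ[K] F, p.map (σ : F →+* F) = p) :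
    ∃ q : K[X], q.map (algebraMap K F) = p := by
  rw [← Polynomial.mem_lifts, Polynomial.lifts_iff_coeff_lifts]
  intro i
  rw [InfiniteGalois.mem_range_algebraMap_iff_fixed]
  intro σ
  have := congrArg (fun q ↦ q.coeff i) (hp σ)
  simpa [coeff_map] using this

end PolynomialLemmas

end Literature.NumberTheory.EllipticCurves

namespace WeierstrassCurve

open Literature.NumberTheory.EllipticCurves geomPoints


variable {K : Type u} [Field K] {W : WeierstrassCurve K}

/-- An infinite set of affine geometric points has infinitely many `x`-coordinates (each `x`
carries at most two points, the tree's `finite_setOf_eq_some`). [folklore] -/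
theorem infinite_image_xy_zero {S : Set W.geomPoints} (hS : S.Infinite) (h0 : ∀ P ∈ S, P ≠ 0) :
    ((fun P ↦ xy P 0) '' S).Infinite := by
  intro hfin
  apply hS
  refine (hfin.biUnion (t := fun x₀ ↦ {P : W.geomPoints |
      ∃ y h, P = (Affine.Point.some x₀ y h : W.geomPoints)}) fun x₀ _ ↦ ?_).subset ?_
  · exact Affine.Point.finite_setOf_eq_some (W := W.baseChange (AlgebraicClosure K)) x₀
  · intro P hP
    simp only [Set.mem_iUnion, Set.mem_image, Set.mem_setOf_eq]
    have hP0 := h0 P hP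
    change (W.baseChange (AlgebraicClosure K)).toAffine.Point at P
    rcases P with _ | ⟨x, y, h⟩
    · exact (hP0 rfl).elim
    · exact ⟨x, ⟨_, hP, by simp⟩, y, h, rfl⟩

end WeierstrassCurve


namespace WeierstrassCurve

namespace Isogeny

open Literature.NumberTheory.EllipticCurves geomPoints


variable {K : Type u} [Field K] {W W' : WeierstrassCurve K} [W.IsElliptic] [W'.IsElliptic]

omit [W'.IsElliptic] in
/-- **The `x`-coordinate of an isogeny is a rational function of `x`** (geometric form): for an
isogeny `φ : E → E'` of elliptic curves over a field `K` of characteristic `0` there are coprime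
`a, b ∈ K̄[X]`, `b` monic, with `x(φ P) = a(x(P))/b(x(P))` (and `b(x(P)) ≠ 0`, `φ P ≠ O`) for all
but finitely many `P ∈ E(K̄)`. Proof: off the exceptional set of a rational representation
`(P₁/Q₁, P₂/Q₂)` of `φ`, `x(φ P) = P₁(P)/Q₁(P) = P₁(P) Q₁(-P) / (Q₁(P) Q₁(-P))`; since
`x(φ(-P)) = x(-φ P) = x(φ P)`, numerator and denominator are even functions on the curve, hence
polynomials in `x` (`exists_eval_eq_of_symmetric`). Silverman, *AEC*, III.§2 (even functions),
proof of Cor. III.2.3.1; cf. Remark III.4.13.3 / Exercise 3.7 (`x ∘ φ` as a rational function of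
`x`). [cite: SilvermanAEC2009, Remark III.4.13.3] -/
theorem exists_xy_apply_eq_eval_div [CharZero K] (φ : Isogeny W W') :
    ∃ (a b : (AlgebraicClosure K)[X]) (S : Set W.geomPoints), S.Finite ∧ IsCoprime a b ∧ b.Monic ∧
      ∀ P ∉ S, P ≠ 0 → φ P ≠ 0 ∧ b.eval (xy P 0) ≠ 0 ∧
        xy (φ P) 0 = a.eval (xy P 0) / b.eval (xy P 0) := by
  set F := AlgebraicClosure K with hF
  set V := (W.baseChange F).toAffine with hV
  set r := φ.rationalRep with hr
  -- the set of points of agreement and the "good" set `G = A ∩ -A`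
  set A : Set W.geomPoints := {P | AgreesWithRationalMapAt W W' r.P₁ r.Q₁ r.P₂ r.Q₂ φ P} with hA
  have hAfin : Aᶜ.Finite := r.finite
  set G : Set W.geomPoints := {P | P ∈ A ∧ -P ∈ A} with hG
  have hGfin : Gᶜ.Finite := by
    have : Gᶜ ⊆ Aᶜ ∪ (fun P : W.geomPoints ↦ -P) ⁻¹' Aᶜ := by
      intro P hP
      simp only [hG, Set.mem_compl_iff, Set.mem_setOf_eq, not_and_or] at hP
      rcases hP with h | h
      · exact Or.inl h
      · exact Or.inr h
    exact ((hAfin.union (hAfin.preimage neg_injective.injOn)).subset this)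
  -- conjugation `g ↦ ḡ`, `ḡ(P) = g(-P)`
  set cj : MvPolynomial (Fin 2) F → MvPolynomial (Fin 2) F := fun g ↦
    MvPolynomial.bind₁ ![MvPolynomial.X 0, -MvPolynomial.X 1 - MvPolynomial.C ((W.baseChange F).a₁) *
      MvPolynomial.X 0 - MvPolynomial.C ((W.baseChange F).a₃)] g with hcj
  have hcjev : ∀ g (x y : F), MvPolynomial.eval ![x, y] (cj g) =
      MvPolynomial.eval ![x, V.negY x y] g := fun g x y ↦ eval_bind₁_negY g x y
  -- pointwise data at a good point
  have hgood : ∀ P ∈ G, ∃ (x y : F) (h : V.Nonsingular x y), P = .some x y h ∧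
      MvPolynomial.eval ![x, y] r.Q₁ ≠ 0 ∧ MvPolynomial.eval ![x, V.negY x y] r.Q₁ ≠ 0 ∧
      φ P ≠ 0 ∧ xy (φ P) 0 = MvPolynomial.eval ![x, y] r.P₁ / MvPolynomial.eval ![x, y] r.Q₁ ∧
      MvPolynomial.eval ![x, y] r.P₁ * MvPolynomial.eval ![x, V.negY x y] r.Q₁ =
        MvPolynomial.eval ![x, V.negY x y] r.P₁ * MvPolynomial.eval ![x, y] r.Q₁ := by
    rintro P ⟨hPA, hPA'⟩
    obtain ⟨hP0, hQ₁, -, h', hφP⟩ := agreesWithRationalMapAt_iff.mp hPA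
    obtain ⟨-, hQ₁', -, h'', hφP'⟩ := agreesWithRationalMapAt_iff.mp hPA'
    cases P with
    | zero => exact (hP0 rfl).elim
    | some x y hxy =>
    refine ⟨x, y, hxy, rfl, hQ₁, hQ₁', ?_, ?_, ?_⟩
    · rw [hφP]; exact Affine.Point.some_ne_zero h'
    · rw [hφP]; rfl
    · -- `x(φ(-P)) = x(-φ P) = x(φ P)`
      rw [map_neg, hφP] at hφP'
      have hx : MvPolynomial.eval (xy (Affine.Point.some x y hxy : W.geomPoints)) r.P₁ /
            MvPolynomial.eval (xy (Affine.Point.some x y hxy : W.geomPoints)) r.Q₁ =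
          MvPolynomial.eval (xy (-(Affine.Point.some x y hxy : W.geomPoints))) r.P₁ /
            MvPolynomial.eval (xy (-(Affine.Point.some x y hxy : W.geomPoints))) r.Q₁ :=
        congrArg (fun Q : W'.geomPoints ↦ xy Q 0) hφP'
      exact (div_eq_div_iff hQ₁ hQ₁').mp hx
  -- (C1) `P₁ Q̄₁ - P̄₁ Q₁` vanishes on the affine curve
  have hC1 : ∀ x y : F, V.Equation x y →
      MvPolynomial.eval ![x, y] (r.P₁ * cj r.Q₁ - cj r.P₁ * r.Q₁) = 0 := by
    intro x y hxy
    refine eval_eq_zero_of_infinite_zeros ?_ hxy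
    refine Set.infinite_of_finite_compl (hGfin.subset ?_)
    intro P hP hPG
    obtain ⟨x', y', h', rfl, -, -, -, -, hcross⟩ := hgood P hPG
    refine hP ⟨Affine.Point.some_ne_zero h', ?_⟩
    rw [xy_some, map_sub, map_mul, map_mul, hcjev, hcjev, hcross, sub_self]
  -- (C2) `N = Q₁ Q̄₁` and `U = P₁ Q̄₁` are even, hence polynomials in `x`
  obtain ⟨n, hn⟩ := W.exists_eval_eq_of_symmetric (r.Q₁ * cj r.Q₁) fun x y hxy ↦ by
    rw [map_mul, map_mul, hcjev, hcjev, Affine.negY_negY, mul_comm]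
  obtain ⟨u, hu⟩ := W.exists_eval_eq_of_symmetric (r.P₁ * cj r.Q₁) fun x y hxy ↦ by
    have h1 := hC1 x y hxy
    rw [map_sub, map_mul, map_mul, hcjev, hcjev, sub_eq_zero] at h1
    rw [map_mul, map_mul, hcjev, hcjev, Affine.negY_negY, h1, mul_comm]
  -- (C3) `x(φ P) = u(x)/n(x)` with `n(x) ≠ 0` at good points
  have hC3 : ∀ P ∈ G, ∃ (x y : F) (h : V.Nonsingular x y), P = .some x y h ∧ φ P ≠ 0 ∧
      n.eval x ≠ 0 ∧ xy (φ P) 0 = u.eval x / n.eval x := by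
    intro P hPG
    obtain ⟨x, y, h, rfl, hQ₁, hQ₁', hφ0, hφx, -⟩ := hgood P hPG
    have hnx : n.eval x = MvPolynomial.eval ![x, y] r.Q₁ * MvPolynomial.eval ![x, V.negY x y] r.Q₁ := by
      rw [← hn x y h.1, map_mul, hcjev]
    have hux : u.eval x = MvPolynomial.eval ![x, y] r.P₁ * MvPolynomial.eval ![x, V.negY x y] r.Q₁ := by
      rw [← hu x y h.1, map_mul, hcjev]
    refine ⟨x, y, h, rfl, hφ0, by rw [hnx]; exact mul_ne_zero hQ₁ hQ₁', ?_⟩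
    rw [hφx, hnx, hux, mul_div_mul_right _ _ hQ₁']
  -- `n ≠ 0`
  have hn0 : n ≠ 0 := by
    obtain ⟨P, hPG⟩ := (Set.infinite_of_finite_compl hGfin).nonempty
    obtain ⟨x, y, h, rfl, -, hnx, -⟩ := hC3 P hPG
    rintro rfl
    exact hnx (eval_zero)
  -- lowest terms, monic denominator
  obtain ⟨a, b, hab, hb, habx⟩ := exists_isCoprime_monic_eval_div_eq u n hn0
  refine ⟨a, b, Gᶜ, hGfin, hab, hb, fun P hP hP0 ↦ ?_⟩
  rw [Set.mem_compl_iff, not_not] at hP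
  obtain ⟨x, y, h, rfl, hφ0, hnx, hφx⟩ := hC3 P hP
  obtain ⟨hbx, habx'⟩ := habx x hnx
  refine ⟨hφ0, hbx, ?_⟩
  rw [xy_some, Matrix.cons_val_zero, hφx, habx']

omit [W'.IsElliptic] in
/-- **Galois descent of the `x`-coordinate map.** If `x(φ P) = a(x(P))/b(x(P))` off a finite set
with `a, b ∈ K̄[X]` coprime and `b` monic (`exists_xy_apply_eq_eval_div`), then `a` and `b` are
fixed by every `σ ∈ Gal(K̄/K)`: `φ` commutes with `σ` (it is defined over `K`), so
`a(σx)/b(σx) = σ(a(x)/b(x))` at the infinitely many `x`-coordinates of good points, whence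
`a · σb = σa · b` and (`map_eq_of_mul_map_eq`) `σa = a`, `σb = b`. Silverman, *AEC*, I.§3
(rational maps defined over `K`), II.§2. [folklore] -/
theorem map_eq_of_xy_apply_eq (φ : Isogeny W W') {a b : (AlgebraicClosure K)[X]}
    (hab : IsCoprime a b) (hb : b.Monic) {S : Set W.geomPoints} (hS : S.Finite)
    (h : ∀ P ∉ S, P ≠ 0 → φ P ≠ 0 ∧ b.eval (xy P 0) ≠ 0 ∧
      xy (φ P) 0 = a.eval (xy P 0) / b.eval (xy P 0))
    (σ : AlgebraicClosure K ≃ₐ[K] AlgebraicClosure K) :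
    a.map (σ : AlgebraicClosure K →+* AlgebraicClosure K) = a ∧
      b.map (σ : AlgebraicClosure K →+* AlgebraicClosure K) = b := by
  set F := AlgebraicClosure K with hF
  set τ : Field.absoluteGaloisGroup K := σ with hτ
  -- good points whose `σ`-translate is good: a cofinite, hence infinite, set of affine points
  set G : Set W.geomPoints := {P | P ∉ S ∧ P ≠ 0 ∧ τ • P ∉ S} with hG
  have hGinf : G.Infinite := by
    refine Set.infinite_of_finite_compl ?_
    have : Gᶜ ⊆ S ∪ {0} ∪ (fun P : W.geomPoints ↦ τ • P) ⁻¹' S := by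
      intro P hP
      simp only [hG, Set.mem_compl_iff, Set.mem_setOf_eq, not_and_or, not_not] at hP
      rcases hP with h1 | h1 | h1
      · exact Or.inl (Or.inl h1)
      · exact Or.inl (Or.inr h1)
      · exact Or.inr h1
    exact ((hS.union (Set.finite_singleton 0)).union
      (hS.preimage (MulAction.injective τ).injOn)).subset this
  -- at such points `a(σx) σ(b x) = σ(a x) b(σx)`
  set E : F[X] := a * b.map (σ : F →+* F) - a.map (σ : F →+* F) * b with hE
  have hroot : ∀ P ∈ G, E.IsRoot (σ (xy P 0)) := by
    rintro P ⟨hPS, hP0, hσPS⟩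
    obtain ⟨hφ0, hbx, hx⟩ := h P hPS hP0
    have hσP0 : τ • P ≠ 0 := fun h0 ↦ hP0 (by
      have := congrArg (fun Q ↦ τ⁻¹ • Q) h0
      simpa using this)
    obtain ⟨-, hbσx, hσx⟩ := h (τ • P) hσPS hσP0
    -- coordinates
    cases P with
    | zero => exact (hP0 rfl).elim
    | some x y hxy =>
    have hxyσ : xy (HSMul.hSMul τ (show W.geomPoints from Affine.Point.some x y hxy) :
        W.geomPoints) 0 = σ x := rfl
    rw [hxyσ] at hbσx hσx
    change xy (φ (Affine.Point.some x y hxy)) 0 = a.eval x / b.eval x at hx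
    change b.eval x ≠ 0 at hbx
    -- `x(φ(σP)) = σ(x(φ P))`
    have hequiv : xy (φ (HSMul.hSMul τ (show W.geomPoints from Affine.Point.some x y hxy) :
        W.geomPoints)) 0 = σ (xy (φ (Affine.Point.some x y hxy)) 0) := by
      rw [φ.map_smul]
      generalize φ (Affine.Point.some x y hxy) = Q at hφ0 ⊢
      cases Q with
      | zero => exact (hφ0 rfl).elim
      | some x' y' h' => rfl
    have hmap : ∀ (p : F[X]) (t : F), (p.map (σ : F →+* F)).eval (σ t) = σ (p.eval t) := by
      intro p t
      rw [eval_map, show σ t = (σ : F →+* F) t from rfl, eval₂_hom]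
      rfl
    rw [hequiv, hx, map_div₀, ← hmap, ← hmap] at hσx
    have hσbx : (b.map (σ : F →+* F)).eval (σ x) ≠ 0 := by
      rw [hmap]
      exact (map_ne_zero_iff _ σ.injective).mpr hbx
    rw [div_eq_div_iff hσbx hbσx] at hσx
    change E.eval (σ x) = 0
    rw [hE, eval_sub, eval_mul, eval_mul, sub_eq_zero]
    exact hσx.symm
  have hE0 : E = 0 := by
    refine Polynomial.eq_zero_of_infinite_isRoot E ?_
    have himg : ((fun t ↦ σ t) '' ((fun P ↦ xy P 0) '' G)).Infinite :=
      (infinite_image_xy_zero hGinf fun P hP ↦ hP.2.1).image σ.injective.injOn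
    refine himg.mono ?_
    rintro _ ⟨_, ⟨P, hP, rfl⟩, rfl⟩
    exact hroot P hP
  rw [hE, sub_eq_zero] at hE0
  exact map_eq_of_mul_map_eq hab hb _ hE0

/-- **`deg φ = max(deg a, deg b)`** when `x(φ P) = a(x(P))/b(x(P))` off a finite set with `a, b`
coprime: the pointwise identity gives `φ^* x' = a(x)/b(x)` in `K̄(E)` (a polynomial with
infinitely many zeros on `E(K̄)` is zero in `K̄(E)`, `evalGeneric_eq_zero_of_finite`), and then
`Isogeny.deg_eq_max_natDegree_of_pullbackX_eq` applies (`[K̄(E) : K̄(φ^* x')] = 2 deg φ`).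
Silverman, *AEC*, III.§4, Remark 4.13.3, Exercise 3.7(d). [cite: SilvermanAEC2009, Remark III.4.13.3] -/
theorem deg_eq_max_natDegree_of_xy_apply_eq (φ : Isogeny W W') {a b : (AlgebraicClosure K)[X]}
    (hab : IsCoprime a b) {S : Set W.geomPoints} (hS : S.Finite)
    (h : ∀ P ∉ S, P ≠ 0 → φ P ≠ 0 ∧ b.eval (xy P 0) ≠ 0 ∧
      xy (φ P) 0 = a.eval (xy P 0) / b.eval (xy P 0)) :
    φ.deg = max a.natDegree b.natDegree := by
  set F := AlgebraicClosure K with hF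
  set r := φ.rationalRep with hr
  set A : Set W.geomPoints := {P | AgreesWithRationalMapAt W W' r.P₁ r.Q₁ r.P₂ r.Q₂ φ P} with hA
  have hAfin : Aᶜ.Finite := r.finite
  set at_ : F[X] → MvPolynomial (Fin 2) F := fun p ↦
    Polynomial.aeval (MvPolynomial.X 0 : MvPolynomial (Fin 2) F) p with hat
  have hat_ev : ∀ (p : F[X]) (v : Fin 2 → F), MvPolynomial.eval v (at_ p) = p.eval (v 0) := by
    intro p v
    have := Polynomial.aeval_algHom_apply (MvPolynomial.aeval v)
      (MvPolynomial.X 0 : MvPolynomial (Fin 2) F) p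
    rw [MvPolynomial.aeval_X, Polynomial.coe_aeval_eq_eval] at this
    rw [hat, ← MvPolynomial.coe_aeval_eq_eval]
    exact this.symm
  have hat_gen : ∀ p : F[X], W.evalGeneric (at_ p) = Polynomial.aeval W.genX p := fun p ↦ by
    rw [hat, evalGeneric_eq_aeval, ← Polynomial.aeval_algHom_apply, MvPolynomial.aeval_X,
      Matrix.cons_val_zero]
  -- `P₁ b(x) - a(x) Q₁` vanishes off `S ∪ Aᶜ`, hence in `K̄(E)`
  have hvan : W.evalGeneric (r.P₁ * at_ b - at_ a * r.Q₁) = 0 := by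
    refine evalGeneric_eq_zero_of_finite (hS.union hAfin) fun P hP hP0 ↦ ?_
    simp only [Set.mem_union, Set.mem_compl_iff, not_or, not_not] at hP
    obtain ⟨hPS, hPA⟩ := hP
    obtain ⟨-, hQ₁, -, h', hφP⟩ := agreesWithRationalMapAt_iff.mp hPA
    obtain ⟨-, hbx, hx⟩ := h P hPS hP0
    have hx' : xy (φ P) 0 = MvPolynomial.eval (xy P) r.P₁ / MvPolynomial.eval (xy P) r.Q₁ := by
      rw [hφP]; rfl
    rw [hx'] at hx
    rw [div_eq_div_iff hQ₁ hbx] at hx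
    rw [map_sub, map_mul, map_mul, hat_ev, hat_ev, sub_eq_zero, hx, mul_comm]
  have hb0 : b ≠ 0 := by
    rintro rfl
    obtain ⟨P, hP, hP0⟩ := geomPoints.exists_not_mem_of_finite (W := W) hS
    exact (h P hP hP0).2.1 (eval_zero)
  have hbgen : Polynomial.aeval W.genX b ≠ 0 := fun h0 ↦
    hb0 ((transcendental_iff_injective.mp (transcendental_genX W)) (by rw [h0, map_zero]))
  have hpull : φ.pullbackX = Polynomial.aeval W.genX a / Polynomial.aeval W.genX b := by
    change W.evalGeneric r.P₁ / W.evalGeneric r.Q₁ = _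
    rw [div_eq_div_iff r.evalGeneric_Q₁_ne_zero hbgen, ← hat_gen, ← hat_gen, ← map_mul, ← map_mul,
      ← sub_eq_zero, ← map_sub, hvan]
  exact φ.deg_eq_max_natDegree_of_pullbackX_eq hab hpull

/-- **`#ker φ = deg φ` in characteristic `0`**: the prelude's `Isogeny.degree = #ker φ` is the
separable degree `[K̄(E) : φ^* K̄(E')]_s` (Silverman, *AEC*, Thm. III.4.10(a), the tree's
`card_ker_eq_finSepDegree_holds`), equal to `deg φ` since `K̄(E)/φ^* K̄(E')` (finite,
*AEC* II.2.4(a), `finiteDimensional_pullbackField_holds`) is separable in characteristic `0`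
(*AEC* III.4.10(c)). [cite: SilvermanAEC2009, Thm. III.4.10(a),(c)] -/
theorem degree_eq_deg [CharZero K] (φ : Isogeny W W') : φ.degree = φ.deg := by
  set L := W.geomFunctionField
  haveI hfin : FiniteDimensional φ.pullbackField L :=
    Isogeny.finiteDimensional_pullbackField_holds W W' φ
  haveI : CharZero L := charZero_of_injective_ringHom (algebraMap K L).injective
  haveI : CharZero φ.pullbackField := (algebraMap φ.pullbackField L).charZero
  haveI : Algebra.IsSeparable φ.pullbackField L :=
    Algebra.IsAlgebraic.isSeparable_of_perfectField
  rw [Isogeny.degree, Isogeny.card_ker_eq_finSepDegree_holds W W' φ,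
    Field.finSepDegree_eq_finrank_of_isSeparable]
  rfl

/-- **The `x`-coordinate of a `K`-isogeny is a `K`-rational function of `x` of degree `deg φ`.**
For an isogeny `φ : E → E'` of elliptic curves over a field `K` of characteristic `0` there are
coprime `a, b ∈ K[X]` with `max(deg a, deg b) = deg φ = #ker φ` such that
`x(φ P) = a(x(P))/b(x(P))` (with `b(x(P)) ≠ 0` and `φ P ≠ O`) for all but finitely many
`P ∈ E(K̄)`. Combines `exists_xy_apply_eq_eval_div` (even functions are rational in `x`),
`map_eq_of_xy_apply_eq` (Galois descent, `K̄^{Γ_K} = K`), `deg_eq_max_natDegree_of_xy_apply_eq`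
and `degree_eq_deg`. Silverman, *AEC*, III.§4, Remark 4.13.3 ("the `x`-coordinate of `φ(P)` is
a rational function of `x(P)` … of degree `deg φ`"), Exercise 3.7(d); I.§3 (descent).
[cite: SilvermanAEC2009, Remark III.4.13.3] -/
theorem exists_xy_apply_eq_eval_map_div [CharZero K] (φ : Isogeny W W') :
    ∃ (a b : K[X]) (S : Set W.geomPoints), S.Finite ∧ IsCoprime a b ∧
      max a.natDegree b.natDegree = φ.degree ∧
      ∀ P ∉ S, P ≠ 0 → φ P ≠ 0 ∧
        (b.map (algebraMap K (AlgebraicClosure K))).eval (xy P 0) ≠ 0 ∧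
        xy (φ P) 0 = (a.map (algebraMap K (AlgebraicClosure K))).eval (xy P 0) /
          (b.map (algebraMap K (AlgebraicClosure K))).eval (xy P 0) := by
  obtain ⟨a, b, S, hS, hab, hb, h⟩ := φ.exists_xy_apply_eq_eval_div
  haveI : IsGalois K (AlgebraicClosure K) := {}
  have hfix := fun σ ↦ φ.map_eq_of_xy_apply_eq hab hb hS h σ
  obtain ⟨a₀, ha₀⟩ := exists_map_eq_of_forall_map_eq (K := K) (p := a) fun σ ↦ (hfix σ).1
  obtain ⟨b₀, hb₀⟩ := exists_map_eq_of_forall_map_eq (K := K) (p := b) fun σ ↦ (hfix σ).2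
  have hinj := (algebraMap K (AlgebraicClosure K)).injective
  refine ⟨a₀, b₀, S, hS, ?_, ?_, ?_⟩
  · rw [← Polynomial.isCoprime_map (algebraMap K (AlgebraicClosure K)), ha₀, hb₀]
    exact hab
  · rw [φ.degree_eq_deg, φ.deg_eq_max_natDegree_of_xy_apply_eq hab hS h, ← ha₀, ← hb₀,
      natDegree_map_eq_of_injective hinj, natDegree_map_eq_of_injective hinj]
  · rw [ha₀, hb₀]
    exact h

end Isogeny

end WeierstrassCurve





end
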